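import Literature.RingTheory.LocalCohomology.CechH2BaseChange
import HarnessLib

/-!
# Noetherianness of `H²` of the Čech complex: transfer along short exact sequences and base change

Topic `Literature/RingTheory/LocalCohomology`, sequel of `CechFiniteness.lean` (`Z1`, `B1`, `H2` — the
cohomology of the extended Čech complex `0 → M → Č⁰ → Č¹ → Č²` in position `2`, i.e. `H²_{(y)}(M)`) and
`CechH2BaseChange.lean`. Three elementary facts used in the proof of Grothendieck's connectedness
theorem (SGA 2 XIII 2.1, `GrothendieckConnectednessProofs.lean`), where the finiteness of a local
cohomology module `H²_𝔠(M)` of a second syzygy module `M` is the analytic input: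

* `isNoetherian_H2_of_exact` — if `0 → M → F → N → 0` is exact and every cocycle of `Č¹(F)` is a
  coboundary (`H²(F) = 0`), then `H²(M)` is a quotient of `Z⁰(N)`; so `H²(M)` is Noetherian when `Z⁰(N)`
  is (the connecting homomorphism `Z⁰(N) → H²(M) → H²(F) = 0`, realised without choice through the
  module of pairs `(c, z)`, `d c = ι z`);
* `h2BaseChange_surjective`, `isNoetherian_H2_baseChange`, `isNoetherian_H2_yB` — the base change map `H²(y; M) → H²(ȳ; M)` of
  `CechH2BaseChange.lean` (for an `R`-algebra `B` and a `B`-module `M`) is surjective, and `H²(ȳ; M)`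
  is a Noetherian `B`-module as soon as `H²(y; M)` is a Noetherian `R`-module;
* `exists_uniform_pow_smul_mem_range` — consequently, for `g ∈ B`, the `g`-power torsion of `H²(ȳ; M)`
  is killed by one fixed power `g^{N₀}`: a cocycle `z` with `g^k z` a coboundary for some `k` has
  `g^{N₀} z` a coboundary.

Everything is proved; no definitions, no named facts.

## References

* [Grothendieck1968SGA2] A. Grothendieck, SGA 2, Exp. II (Čech computation of `H^i_Y`), Exp. XIII §2
  (arXiv:math/0511279).
* [Eisenbud2005] D. Eisenbud, *The Geometry of Syzygies*, GTM 229, Appendix 1, Thm. A1.3.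
-/

noncomputable section

open CategoryTheory

universe u

namespace Literature.RingTheory.LocalCohomology

variable {R : Type u} [CommRing R] {s : ℕ}

/-! ## `H²(M)` is a quotient of `Z⁰(N)` for `0 → M → F → N → 0` with `H²(F) = 0` -/

section Connecting

variable {y : Fin s → R} {M F N : Type u} [AddCommGroup M] [Module R M] [AddCommGroup F]
  [Module R F] [AddCommGroup N] [Module R N] (ι : M →ₗ[R] F) (π : F →ₗ[R] N)

/-- **`H²(M)` is Noetherian when `Z⁰(N)` is**, for a short exact sequence `0 → M →ι F →π N → 0` of
`R`-modules such that every cocycle of `Č¹(F)` is a coboundary. (The connecting homomorphism of the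
long exact cohomology sequence of `0 → Č(M) → Č(F) → Č(N) → 0` maps `Z⁰(N)` onto `H²(M)` because the
next term `H²(F)` vanishes; we realise it through the module `P` of pairs `(c, z) ∈ Č⁰(F) × Č¹(M)` with
`d c = ι z`, which maps onto both `Z⁰(N)` (by `(c, z) ↦ π c`) and `H²(M)` (by `(c, z) ↦ [z]`), the
kernel of the first map being contained in that of the second.) [folklore] -/
theorem isNoetherian_H2_of_exact (hι : Function.Injective ι) (hπ : Function.Surjective π)
    (hex : Function.Exact ι π)
    (hF2 : ∀ z : CechObj y F 1, dC 1 z = 0 → ∃ c : CechObj y F 0, dC 0 c = z)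
    [IsNoetherian R (LinearMap.ker (dC (y := y) (M := N) 0))] :
    IsNoetherian R (H2 (y := y) (M := M)) := by
  -- the module of pairs `(c, z)` with `d c = ι z`
  let δ : (CechObj y F 0 × CechObj y M 1) →ₗ[R] CechObj y F 1 :=
    (dC 0).comp (LinearMap.fst R _ _) - (cechObjMap y ι 1).comp (LinearMap.snd R _ _)
  let P : Submodule R (CechObj y F 0 × CechObj y M 1) := LinearMap.ker δ
  have hP : ∀ p : P, dC 0 (p : CechObj y F 0 × CechObj y M 1).1 =
      cechObjMap y ι 1 (p : CechObj y F 0 × CechObj y M 1).2 := fun p => by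
    have h := LinearMap.mem_ker.mp p.2
    exact sub_eq_zero.mp h
  -- `p₁ : P → Z⁰(N)`, `(c, z) ↦ π c`
  have hp1mem : ∀ p : P, cechObjMap y π 0 (p : CechObj y F 0 × CechObj y M 1).1 ∈
      LinearMap.ker (dC (y := y) (M := N) 0) := fun p => by
    rw [LinearMap.mem_ker, dC_cechObjMap, hP p]
    exact ((cechObjMap_exact y ι π hex 1) _).mpr ⟨_, rfl⟩
  let p₁ : P →ₗ[R] LinearMap.ker (dC (y := y) (M := N) 0) :=
    LinearMap.codRestrict _ ((cechObjMap y π 0).comp ((LinearMap.fst R _ _).comp P.subtype)) hp1mem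
  have p₁_apply : ∀ p : P, (p₁ p : CechObj y N 0) =
      cechObjMap y π 0 (p : CechObj y F 0 × CechObj y M 1).1 := fun p => rfl
  -- `p₂ : P → H²(M)`, `(c, z) ↦ [z]`
  have hp2mem : ∀ p : P, (p : CechObj y F 0 × CechObj y M 1).2 ∈ Z1 (y := y) (M := M) := fun p => by
    rw [LinearMap.mem_ker]
    apply cechObjMap_injective y ι hι 2
    rw [← dC_cechObjMap, ← hP p, dC_dC, map_zero]
  let p₂ : P →ₗ[R] H2 (y := y) (M := M) :=
    (B1 (y := y) (M := M)).mkQ.comp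
      (LinearMap.codRestrict (Z1 (y := y) (M := M)) ((LinearMap.snd R _ _).comp P.subtype) hp2mem)
  have p₂_apply : ∀ p : P, p₂ p =
      H2.mk (p : CechObj y F 0 × CechObj y M 1).2 (LinearMap.mem_ker.mp (hp2mem p)) := fun p => rfl
  -- `p₁` is onto
  have hp1 : Function.Surjective p₁ := by
    rintro ⟨ν, hν⟩
    obtain ⟨c, hc⟩ := cechObjMap_surjective y π hπ 0 ν
    have h1 : cechObjMap y π 1 (dC 0 c) = 0 := by
      rw [← dC_cechObjMap, hc]
      exact LinearMap.mem_ker.mp hν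
    obtain ⟨z, hz⟩ := ((cechObjMap_exact y ι π hex 1) _).mp h1
    have hmem : ((c, z) : CechObj y F 0 × CechObj y M 1) ∈ P := by
      rw [LinearMap.mem_ker]
      change dC 0 c - cechObjMap y ι 1 z = 0
      rw [hz, sub_self]
    exact ⟨⟨(c, z), hmem⟩, Subtype.ext (by rw [p₁_apply]; exact hc)⟩
  -- `p₂` is onto (uses `H²(F) = 0`)
  have hp2 : Function.Surjective p₂ := by
    intro e
    obtain ⟨⟨z, hz⟩, rfl⟩ := Submodule.mkQ_surjective _ e
    have hz' : dC 1 z = 0 := LinearMap.mem_ker.mp hz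
    have h1 : dC 1 (cechObjMap y ι 1 z) = 0 := by rw [dC_cechObjMap, hz', map_zero]
    obtain ⟨c, hc⟩ := hF2 _ h1
    have hmem : ((c, z) : CechObj y F 0 × CechObj y M 1) ∈ P := by
      rw [LinearMap.mem_ker]
      change dC 0 c - cechObjMap y ι 1 z = 0
      rw [hc, sub_self]
    exact ⟨⟨(c, z), hmem⟩, rfl⟩
  -- `ker p₁ ≤ ker p₂`
  have hker : LinearMap.ker p₁ ≤ LinearMap.ker p₂ := by
    intro p hp
    rw [LinearMap.mem_ker] at hp ⊢
    have hp' : cechObjMap y π 0 (p : CechObj y F 0 × CechObj y M 1).1 = 0 := by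
      rw [← p₁_apply, hp]; rfl
    obtain ⟨m, hm⟩ := ((cechObjMap_exact y ι π hex 0) _).mp hp'
    have hz : (p : CechObj y F 0 × CechObj y M 1).2 = dC 0 m := by
      apply cechObjMap_injective y ι hι 1
      rw [← hP p, ← hm, dC_cechObjMap]
    rw [p₂_apply, H2.mk_eq_zero_iff]
    exact ⟨m, hz.symm⟩
  -- `Z⁰(N) ≃ P / ker p₁ ↠ H²(M)`
  let q : (P ⧸ LinearMap.ker p₁) →ₗ[R] H2 (y := y) (M := M) := (LinearMap.ker p₁).liftQ p₂ hker
  have hq : Function.Surjective q := by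
    intro e
    obtain ⟨p, rfl⟩ := hp2 e
    exact ⟨Submodule.Quotient.mk p, rfl⟩
  haveI : IsNoetherian R (P ⧸ LinearMap.ker p₁) :=
    isNoetherian_of_linearEquiv (p₁.quotKerEquivOfSurjective hp1).symm
  exact isNoetherian_of_surjective q (LinearMap.range_eq_top.mpr hq)

end Connecting

/-! ## Base change on `H²` is surjective -/

section BaseChange

variable (B : Type u) [CommRing B] [Algebra R B] (y : Fin s → R) (M : Type u) [AddCommGroup M]
  [Module R M] [Module B M] [IsScalarTower R B M]

/-- **The base change map `H²(y; M) → H²(ȳ; M)` is surjective** (it is induced by isomorphisms of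
cochain modules commuting with the differentials, `cechObjBaseChange`, `dC_cechObjBaseChange`).
[folklore] -/
theorem h2BaseChange_surjective : Function.Surjective (h2BaseChange B y M) := by
  intro e
  obtain ⟨⟨z, hz⟩, rfl⟩ := Submodule.mkQ_surjective _ e
  have hz0 : dC 1 z = 0 := LinearMap.mem_ker.mp hz
  set z' : CechObj y M 1 := (cechObjBaseChange B y M 1).symm z with hz'def
  have hz' : dC 1 z' = 0 := by
    apply (cechObjBaseChange B y M 2).injective
    rw [← dC_cechObjBaseChange, hz'def, LinearEquiv.apply_symm_apply, map_zero, hz0]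
  refine ⟨Submodule.Quotient.mk ⟨z', LinearMap.mem_ker.mpr hz'⟩, ?_⟩
  change Submodule.mapQ _ _ (z1BaseChange B y M) _ (Submodule.Quotient.mk ⟨z', _⟩) = _
  rw [Submodule.mapQ_apply]
  change Submodule.Quotient.mk (z1BaseChange B y M ⟨z', _⟩) = Submodule.Quotient.mk ⟨z, hz⟩
  congr 1
  apply Subtype.ext
  change cechObjBaseChange B y M 1 z' = z
  rw [hz'def, LinearEquiv.apply_symm_apply]

/-- **`H²(ȳ; M)` (over `B`, restricted to `R`) is Noetherian when `H²(y; M)` (over `R`) is.**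
[folklore] -/
theorem isNoetherian_H2_baseChange [IsNoetherian R (H2 (y := y) (M := M))] :
    IsNoetherian R ((Z1 (y := yB B y) (M := M)).restrictScalars R ⧸
      ((B1 (y := yB B y) (M := M)).restrictScalars R)) :=
  isNoetherian_of_surjective (h2BaseChange B y M)
    (LinearMap.range_eq_top.mpr (h2BaseChange_surjective B y M))

/-- **`H²(ȳ; M)` is a Noetherian `B`-module when `H²(y; M)` is a Noetherian `R`-module**: the base
change `H²(y; M) → H²(ȳ; M)` (class of `z` ↦ class of `z` read over `B`) is an `R`-linear surjection,
and an `R`-Noetherian `B`-module is `B`-Noetherian. [folklore] -/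
theorem isNoetherian_H2_yB [IsNoetherian R (H2 (y := y) (M := M))] :
    IsNoetherian B (H2 (y := yB B y) (M := M)) := by
  -- the `R`-linear base change map on cocycles, into the `B`-module `Z¹(ȳ; M)`
  let z1 : Z1 (y := y) (M := M) →ₗ[R] Z1 (y := yB B y) (M := M) :=
    LinearMap.codRestrict ((Z1 (y := yB B y) (M := M)).restrictScalars R)
      ((cechObjBaseChange B y M 1).toLinearMap.comp (Z1 (y := y) (M := M)).subtype) (by
        intro z
        change dC 1 (cechObjBaseChange B y M 1 (z : CechObj y M 1)) = 0
        rw [dC_cechObjBaseChange, LinearMap.mem_ker.mp z.2, map_zero])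
  have z1_coe : ∀ z : Z1 (y := y) (M := M),
      ((z1 z : Z1 (y := yB B y) (M := M)) : CechObj (yB B y) M 1) =
        cechObjBaseChange B y M 1 (z : CechObj y M 1) := fun z => rfl
  -- it maps coboundaries to coboundaries, hence descends to `H²`
  let f : H2 (y := y) (M := M) →ₗ[R] H2 (y := yB B y) (M := M) :=
    (B1 (y := y) (M := M)).liftQ (((B1 (y := yB B y) (M := M)).mkQ.restrictScalars R).comp z1) (by
      intro z hz
      rw [LinearMap.mem_ker, LinearMap.comp_apply, LinearMap.restrictScalars_apply,
        Submodule.mkQ_apply, Submodule.Quotient.mk_eq_zero]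
      change ((z1 z : Z1 (y := yB B y) (M := M)) : CechObj (yB B y) M 1) ∈ LinearMap.range (dC 0)
      obtain ⟨w, hw⟩ : ((z : Z1 (y := y) (M := M)) : CechObj y M 1) ∈ LinearMap.range (dC 0) := hz
      refine ⟨cechObjBaseChange B y M 0 w, ?_⟩
      rw [z1_coe, dC_cechObjBaseChange, hw])
  have hf : Function.Surjective f := by
    intro e
    obtain ⟨⟨z, hz⟩, rfl⟩ := Submodule.mkQ_surjective _ e
    have hz0 : dC 1 z = 0 := LinearMap.mem_ker.mp hz
    set z' : CechObj y M 1 := (cechObjBaseChange B y M 1).symm z with hz'def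
    have hz' : dC 1 z' = 0 := by
      apply (cechObjBaseChange B y M 2).injective
      rw [← dC_cechObjBaseChange, hz'def, LinearEquiv.apply_symm_apply, map_zero, hz0]
    refine ⟨Submodule.Quotient.mk ⟨z', LinearMap.mem_ker.mpr hz'⟩, ?_⟩
    change Submodule.Quotient.mk (z1 ⟨z', _⟩) = Submodule.Quotient.mk ⟨z, hz⟩
    congr 1
    apply Subtype.ext
    rw [z1_coe]
    change cechObjBaseChange B y M 1 z' = z
    rw [hz'def, LinearEquiv.apply_symm_apply]
  haveI : IsNoetherian R (H2 (y := yB B y) (M := M)) :=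
    isNoetherian_of_surjective f (LinearMap.range_eq_top.mpr hf)
  exact isNoetherian_of_tower R inferInstance

/-- **Uniform bound on the `g`-power torsion of `H²(ȳ; M)`.** If `H²(y; M)` is a Noetherian `R`-module,
then for every `g ∈ B` there is `N₀` such that every cocycle `z ∈ Z¹(ȳ; M)` some `g`-power multiple of
which is a coboundary already has `g^{N₀} z` a coboundary (the kernels of the iterates of
multiplication by `g` on the Noetherian module `H²(ȳ; M)` stabilise). [folklore] -/
theorem exists_uniform_pow_smul_mem_range [IsNoetherian R (H2 (y := y) (M := M))] (g : B) :
    ∃ N₀ : ℕ, ∀ z : CechObj (yB B y) M 1, dC 1 z = 0 →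
      (∃ (k : ℕ) (w : CechObj (yB B y) M 0), dC 0 w = g ^ k • z) →
        ∃ w : CechObj (yB B y) M 0, dC 0 w = g ^ N₀ • z := by
  have hN : IsNoetherian B (H2 (y := yB B y) (M := M)) := isNoetherian_H2_yB B y M
  have hmemB : ∀ x : Z1 (y := yB B y) (M := M), x ∈ B1 (y := yB B y) (M := M) ↔
      ∃ w : CechObj (yB B y) M 0, dC 0 w = (x : CechObj (yB B y) M 1) := fun x => by
    change (x : CechObj (yB B y) M 1) ∈ LinearMap.range (dC 0) ↔ _
    rw [LinearMap.mem_range]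
  -- multiplication by `g` on `Z¹(ȳ; M)` preserves the coboundaries, hence descends to `H²`
  let ψ : Z1 (y := yB B y) (M := M) →ₗ[B] Z1 (y := yB B y) (M := M) := g • LinearMap.id
  have hψ_coe : ∀ x : Z1 (y := yB B y) (M := M),
      ((ψ x : Z1 (y := yB B y) (M := M)) : CechObj (yB B y) M 1) = g • (x : CechObj (yB B y) M 1) :=
    fun x => rfl
  have hψB : B1 (y := yB B y) (M := M) ≤ (B1 (y := yB B y) (M := M)).comap ψ := fun x hx => by
    rw [Submodule.mem_comap, hmemB, hψ_coe]
    obtain ⟨w, hw⟩ := (hmemB x).mp hx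
    exact ⟨g • w, by rw [LinearMap.map_smul, hw]⟩
  let φ : H2 (y := yB B y) (M := M) →ₗ[B] H2 (y := yB B y) (M := M) := Submodule.mapQ _ _ ψ hψB
  have hφ : ∀ (k : ℕ) (x : Z1 (y := yB B y) (M := M)),
      (φ ^ k) (Submodule.Quotient.mk x) = Submodule.Quotient.mk ((ψ ^ k) x) := by
    intro k x
    induction k with
    | zero => simp
    | succ k ih =>
      rw [pow_succ', Module.End.mul_apply, ih, pow_succ', Module.End.mul_apply]
      rfl
  have hψk : ∀ (k : ℕ) (x : Z1 (y := yB B y) (M := M)),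
      (((ψ ^ k) x : Z1 (y := yB B y) (M := M)) : CechObj (yB B y) M 1) =
        g ^ k • (x : CechObj (yB B y) M 1) := by
    intro k x
    induction k with
    | zero => simp
    | succ k ih => rw [pow_succ', Module.End.mul_apply, hψ_coe, ih, smul_smul, ← pow_succ']
  -- the kernels of the iterates of `φ` stabilise
  obtain ⟨N₀, hN₀⟩ := (monotone_stabilizes_iff_noetherian.mpr hN) φ.iterateKer
  refine ⟨N₀, fun z hz ⟨k, w, hw⟩ => ?_⟩
  rcases le_total k N₀ with hk | hk
  · refine ⟨g ^ (N₀ - k) • w, ?_⟩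
    rw [LinearMap.map_smul, hw, smul_smul, ← pow_add, Nat.sub_add_cancel hk]
  · let x : Z1 (y := yB B y) (M := M) := ⟨z, LinearMap.mem_ker.mpr hz⟩
    have hmem : Submodule.Quotient.mk x ∈ φ.iterateKer k := by
      change Submodule.Quotient.mk x ∈ LinearMap.ker (φ ^ k)
      rw [LinearMap.mem_ker, hφ, Submodule.Quotient.mk_eq_zero, hmemB, hψk]
      exact ⟨w, hw⟩
    rw [← hN₀ k hk] at hmem
    change Submodule.Quotient.mk x ∈ LinearMap.ker (φ ^ N₀) at hmem
    rw [LinearMap.mem_ker, hφ, Submodule.Quotient.mk_eq_zero, hmemB, hψk] at hmem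
    exact hmem

end BaseChange

end Literature.RingTheory.LocalCohomology

end
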